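/-
Copyright (c) 2026 the pub-hodgecm-mathlib formalisation cell (harness21).  Prover seat hodgecm-mathlib-K2E4-p18 (g3), HCML Track B «K2-LIT» ∕ h413
(stmt-HodgeConjecture-24833); line (ii′), sub-letter (H♮): FILE 4b, THE PAYER of (Ψ-package♮) modulo the rank-one target (line lead K2E4-p06 (g2) GO 2026-09-04T00:04:24Z).
-/
import Summits.HodgeConjecture.HodgeConjecture.Theorems.K2E3CentralUnipotentScalingOfFactor                -- FILE 4a (this seat): the (SC) transport `U₂ → H_v`; brings the U3b frame, ★ p23 `fst_comm_of_mem_center` ∕ `cmDatum_local_one_mul_comm`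
import Summits.HodgeConjecture.HodgeConjecture.Theorems.F0P3cStCharTSEllMassHOrbEll                         -- ★ `compactSpace_centralizerH_of_fst` (`Z_H((γ₂, γ₁))` compact when `Z(γ₂)` is, non-split `v`)
import Literature.NumberTheory.Rogawski1990.LocalStableClassesNonsplitRankTwoIrreducible    -- ★ `isConj_of_isStablyConjH_of_irreducible`, `setOf_st_out_eq_singleton` (type (2): ONE class)
import Literature.NumberTheory.Rogawski1990.UnitStableOrbitalIntegralIrredOneClass          -- ★ `adelicForm_antidiagTwo_local_hermitian`, `isUnit_det_adelicForm_antidiagTwo_local`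
import Literature.NumberTheory.Weil1982.UnitaryLocalRingBaseField                        -- ★ `exists_complexConj_eq_neg_ne_zero`
import HarnessLib

/-!
# K2 · E3 — `Theorems/K2E3CentralUnipotentScalingPackageOfRankOne.lean`: (Ψ-package♮) ON `H_v = U(Φ₂)_v × U(Φ₁)_v` AT A CENTRAL `z` FROM THE RANK-ONE PACKAGE ON
# `U(Φ₂)_v` AT `z.1` (product with the compact abelian `U(Φ₁)_v`; Rogawski 1990 §4.9, §8.1 Prop. 8.1.2; §3.5–3.6 for the type-(2) count)

HCML Track B «K2-LIT», cell `pub/hodgecm-mathlib`, crux H413 = `stmt-HodgeConjecture-24833` (lane `--supports … --as helper`); seat `hodgecm-mathlib-K2E4-p18` (g3).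
THE LAST H-SIDE JUNCTION of sub-letter (H♮): ★ p855910 consumes (Ψ-package♮) `sig_K2E3CentralUnipotentScalingPackage` (cand 3b2da8799baa6d2f); THIS FILE pays it from the
U₂-LEVEL cand (Ψ-package₂⁺) `sig_K2E3RankOneUnipotentScalingPackage` (bytes `K2/K2E4-p18/g3/sig_K2E3RankOneUnipotentScalingPackage.cand.K2E4-p18-g3.lean`) — the target of
the rank-one Cayley road (★ K2E5-p12 FILE 1∕2∕3 + the (SC₂) C-file) — so that NO H_v-level work remains for the Cayley hand.

THE CONSTRUCTION.  Given `(Ψ, U₀, q, a)` on `U₂` at `ζ = z.1` (central in `U₂` by ★ `fst_comm_of_mem_center`): `Ψ_H(γ) := (Ψ γ.1, γ.2)`, `U₀^H := U₀ × U₁`,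
`a_H(u) := a(⟦(out u).1⟧)` on `⟦z⟧` and `max 1 (a ⟦(out u).1⟧)` elsewhere (equal to `a(⟦(out u).1⟧)` on every class over `z`), `γs := (t, z.2)` with `t` the (RAY⁺) start
for `λ = z.2`.  (U1)(U2)(C) componentwise; (E)(Z)(I) componentwise with `U₁` commutative (★ `cmDatum_local_one_mul_comm`); (U2st)(Est)(Sst) from the `U₂`-clauses, stable
conjugacy on `H_v` being componentwise (★ `IsStablyConjH = IsStablyConj × IsStablyConj`, spelled `IsLocalStablyConjH L v (·, 1) (·, 1)` on the first slot); (S) is the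
package's (S_H); (RAY♮): `Ψ_H^[k] γs = (Ψ^[k] t, z.2)` is `G`-regular, has compact centraliser (★ `compactSpace_centralizerH_of_fst`), tends to `z`, and its stable class
is ONE class — ★ `isConj_of_isStablyConjH_of_irreducible` (irreducible `χ` of the `U₂`-slot: type (2), [Rogawski1990 Prop. 3.5.2 (c) pp. 25–26]) + ★ `setOf_st_out_eq_singleton`;
(SC) = FILE 4a ★ `classOrbitalIntegral_indicator_comp_prod_eq_mul`.

* §1 small lemmas (`iterate_prodMap_fst`, `eq_of_isConj_of_mem_center`; the exponent bookkeeping `aH` is inside the head; ★ `exists_complexConj_eq_neg_ne_zero` by name).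
* §2 **`centralUnipotentScalingPackage_of_rankOne : ‹(Ψ-package₂⁺)› → ‹(Ψ-package♮) 3b2da879›`** — THE HEAD (conclusion VERBATIM).

HONEST LABEL: HC_CM is proved only modulo the 7 printed citations (2 remaining named inputs: hLiu418 = stmt-HodgeConjecture-24832, h413 = stmt-HodgeConjecture-24833) until rung 0 closes.
Count-neutral helper: (Ψ-package♮) becomes REL ⟸ (Ψ-package₂⁺); with ★ p855908∕p855909∕p855910, CERT♮ ★ p855822 and ★ (DUAL_z) p855937 the cone of (H♮)∕(ii♭′) on this
side is {(E) → K2E3-p23, (Ψ-package₂⁺) → the Cayley hand, (S′♮) ★}.  No `sorry`, axioms ⊆ {propext, Classical.choice, Quot.sound}, no `def`, no instance, no notation.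

## References
* [Rogawski1990] J. D. Rogawski, *Automorphic Representations of Unitary Groups in Three Variables*, Ann. of Math. Stud. 123 (1990): §4.9 p. 54; §8.1 Props. 8.1.1–8.1.2
  pp. 112–114; §3.5 Prop. 3.5.2 (c) pp. 25–26; §3.6 Lemma 3.6.1 p. 28, Cartan types p. 29.
* [HarishChandra1999AdmissibleDistributions] Harish-Chandra (notes by S. DeBacker, P. J. Sally, Jr.), AMS ULS 16 (1999): §3.1 Lemma 3.2.
* [Flicker1998UnitaryFL] Y. Z. Flicker, Canad. J. Math. 50 (1998), p. 97 (one class in the stable class of Flicker's torus).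
-/

set_option autoImplicit false
set_option linter.dupNamespace false

noncomputable section

open Filter Topology
open MeasureTheory Measure NumberField IsDedekindDomain
open Literature.MeasureTheory.Group Literature.MeasureTheory.RestrictedProduct
open Literature.Topology.RestrictedProduct Literature.Topology.Algebra.RestrictedProduct
open Literature.NumberTheory.Rogawski1990 Literature.NumberTheory.Automorphic
open Literature.AlgebraicGeometry.ShimuraVarieties (unitaryGroup hermForm)
open scoped Matrix MatrixGroups RestrictedProduct NNReal
open Summit.HodgeConjecture.HodgeConjecture.Cruxes.H413.K2E3CentralUnipotentScalingOfFactor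
open Summit.HodgeConjecture.HodgeConjecture.Cruxes.H413.F0P3cStCharTSEllMassHOrbEll (compactSpace_centralizerH_of_fst)

namespace Summit.HodgeConjecture.HodgeConjecture.Cruxes.H413.K2E3CentralUnipotentScalingPackageOfRankOne

variable (L : Type) [Field L] [NumberField L] [IsCMField L] (v : HeightOneSpectrum (𝓞 ↥(maximalRealSubfield L)))

/-! ## §1 Small lemmas -/

/-- Iterates of the product map `Ψ × id`: `(Ψ × id)^[k] (t, λ) = (Ψ^[k] t, λ)`. [folklore] -/
theorem iterate_prodMap_fst (Ψ : (UnitaryGroup.cmDatum L 2 (Matrix.of fun i j : Fin 2 => if i.val + j.val + 1 = 2 then (1 : L) else 0)).Local v → (UnitaryGroup.cmDatum L 2 (Matrix.of fun i j : Fin 2 => if i.val + j.val + 1 = 2 then (1 : L) else 0)).Local v) (t : (UnitaryGroup.cmDatum L 2 (Matrix.of fun i j : Fin 2 => if i.val + j.val + 1 = 2 then (1 : L) else 0)).Local v) (lam : (UnitaryGroup.cmDatum L 1 (Matrix.of fun i j : Fin 1 => if i.val + j.val + 1 = 1 then (1 : L) else 0)).Local v) (k : ℕ) :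
    (fun γ : (UnitaryGroup.cmDatum L 2 (Matrix.of fun i j : Fin 2 => if i.val + j.val + 1 = 2 then (1 : L) else 0)).Local v × (UnitaryGroup.cmDatum L 1 (Matrix.of fun i j : Fin 1 => if i.val + j.val + 1 = 1 then (1 : L) else 0)).Local v => (Ψ γ.1, γ.2))^[k] (t, lam) = (Ψ^[k] t, lam) := by
  induction k with
  | zero => rfl
  | succ k ih => rw [Function.iterate_succ_apply', Function.iterate_succ_apply', ih]

/-- A central element is its own conjugates: `out ⟦z⟧ = z` and every conjugate of `z.1` is `z.1`. [folklore] -/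
theorem eq_of_isConj_of_mem_center {G : Type*} [Group G] {z g : G} (hz : z ∈ Subgroup.center G) (h : IsConj z g) : g = z := by
  obtain ⟨c, hc⟩ := isConj_iff.1 h
  rw [← hc, Subgroup.mem_center_iff.1 hz c, mul_inv_cancel_right]

/-! ## §2 The head -/

/-- **(Ψ-package♮) ⟸ (Ψ-package₂⁺).**  Hypothesis = the cand `…U3bCentralGerms.sig_K2E3RankOneUnipotentScalingPackage` VERBATIM; conclusion = (Ψ-package♮)
`…U3bCentralGerms.sig_K2E3CentralUnipotentScalingPackage` (cand 3b2da8799baa6d2f, consumed by ★ p855910) VERBATIM.  Construction and clause-by-clause proof: module docstring.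
[cite: Rogawski1990, §4.9 p. 54; §8.1 Props. 8.1.1–8.1.2 pp. 112–114; §3.5 Prop. 3.5.2 (c) pp. 25–26] [cite: Flicker1998UnitaryFL, p. 97] -/
theorem centralUnipotentScalingPackage_of_rankOne
    (hpkg :
    ∀ (L : Type) [Field L] [NumberField L] [IsCMField L] (v : HeightOneSpectrum (𝓞 ↥(maximalRealSubfield L)))
      [MeasurableSpace ((UnitaryGroup.cmDatum L 2 (Matrix.of fun i j : Fin 2 => if i.val + j.val + 1 = 2 then (1 : L) else 0)).Local v)] [BorelSpace ((UnitaryGroup.cmDatum L 2 (Matrix.of fun i j : Fin 2 => if i.val + j.val + 1 = 2 then (1 : L) else 0)).Local v)]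
      [∀ γ : (UnitaryGroup.cmDatum L 2 (Matrix.of fun i j : Fin 2 => if i.val + j.val + 1 = 2 then (1 : L) else 0)).Local v, MeasurableSpace ((UnitaryGroup.cmDatum L 2 (Matrix.of fun i j : Fin 2 => if i.val + j.val + 1 = 2 then (1 : L) else 0)).Local v ⧸ Subgroup.centralizer ({γ} : Set ((UnitaryGroup.cmDatum L 2 (Matrix.of fun i j : Fin 2 => if i.val + j.val + 1 = 2 then (1 : L) else 0)).Local v)))]
      [∀ γ : (UnitaryGroup.cmDatum L 2 (Matrix.of fun i j : Fin 2 => if i.val + j.val + 1 = 2 then (1 : L) else 0)).Local v, BorelSpace ((UnitaryGroup.cmDatum L 2 (Matrix.of fun i j : Fin 2 => if i.val + j.val + 1 = 2 then (1 : L) else 0)).Local v ⧸ Subgroup.centralizer ({γ} : Set ((UnitaryGroup.cmDatum L 2 (Matrix.of fun i j : Fin 2 => if i.val + j.val + 1 = 2 then (1 : L) else 0)).Local v)))],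
      Subsingleton (UnitaryGroup.PlacesOver L v) →
    ∀ ζ : (UnitaryGroup.cmDatum L 2 (Matrix.of fun i j : Fin 2 => if i.val + j.val + 1 = 2 then (1 : L) else 0)).Local v, ζ ∈ Subgroup.center ((UnitaryGroup.cmDatum L 2 (Matrix.of fun i j : Fin 2 => if i.val + j.val + 1 = 2 then (1 : L) else 0)).Local v) →
    ∃ (Ψ : (UnitaryGroup.cmDatum L 2 (Matrix.of fun i j : Fin 2 => if i.val + j.val + 1 = 2 then (1 : L) else 0)).Local v → (UnitaryGroup.cmDatum L 2 (Matrix.of fun i j : Fin 2 => if i.val + j.val + 1 = 2 then (1 : L) else 0)).Local v) (U₀ : Set ((UnitaryGroup.cmDatum L 2 (Matrix.of fun i j : Fin 2 => if i.val + j.val + 1 = 2 then (1 : L) else 0)).Local v)) (q : ℂ) (a : ConjClasses ((UnitaryGroup.cmDatum L 2 (Matrix.of fun i j : Fin 2 => if i.val + j.val + 1 = 2 then (1 : L) else 0)).Local v) → ℕ),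
      U₀ ∈ 𝓝 ζ ∧
      (∀ γ ∈ U₀, ∀ x : (UnitaryGroup.cmDatum L 2 (Matrix.of fun i j : Fin 2 => if i.val + j.val + 1 = 2 then (1 : L) else 0)).Local v, x * γ * x⁻¹ ∈ U₀) ∧
      (∀ γ ∈ U₀, ∀ δ : (UnitaryGroup.cmDatum L 2 (Matrix.of fun i j : Fin 2 => if i.val + j.val + 1 = 2 then (1 : L) else 0)).Local v, IsLocalStablyConjH L v (γ, (1 : (UnitaryGroup.cmDatum L 1 (Matrix.of fun i j : Fin 1 => if i.val + j.val + 1 = 1 then (1 : L) else 0)).Local v)) (δ, (1 : (UnitaryGroup.cmDatum L 1 (Matrix.of fun i j : Fin 1 => if i.val + j.val + 1 = 1 then (1 : L) else 0)).Local v)) → δ ∈ U₀) ∧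
      (∀ γ ∈ U₀, ∀ x : (UnitaryGroup.cmDatum L 2 (Matrix.of fun i j : Fin 2 => if i.val + j.val + 1 = 2 then (1 : L) else 0)).Local v, Ψ (x * γ * x⁻¹) = x * Ψ γ * x⁻¹) ∧
      (∀ γ ∈ U₀, ∀ y : (UnitaryGroup.cmDatum L 2 (Matrix.of fun i j : Fin 2 => if i.val + j.val + 1 = 2 then (1 : L) else 0)).Local v, y * γ = γ * y ↔ y * Ψ γ = Ψ γ * y) ∧
      (∀ γ ∈ U₀, ∀ δ ∈ U₀, IsLocalStablyConjH L v (γ, (1 : (UnitaryGroup.cmDatum L 1 (Matrix.of fun i j : Fin 1 => if i.val + j.val + 1 = 1 then (1 : L) else 0)).Local v)) (δ, (1 : (UnitaryGroup.cmDatum L 1 (Matrix.of fun i j : Fin 1 => if i.val + j.val + 1 = 1 then (1 : L) else 0)).Local v)) → IsLocalStablyConjH L v (Ψ γ, (1 : (UnitaryGroup.cmDatum L 1 (Matrix.of fun i j : Fin 1 => if i.val + j.val + 1 = 1 then (1 : L) else 0)).Local v)) (Ψ δ, (1 : (UnitaryGroup.cmDatum L 1 (Matrix.of fun i j : Fin 1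 => if i.val + j.val + 1 = 1 then (1 : L) else 0)).Local v))) ∧
      (∀ γ ∈ U₀, ∀ δ ∈ U₀, Ψ γ = Ψ δ → γ = δ) ∧
      (∀ γ ∈ U₀, ∀ η : (UnitaryGroup.cmDatum L 2 (Matrix.of fun i j : Fin 2 => if i.val + j.val + 1 = 2 then (1 : L) else 0)).Local v, IsLocalStablyConjH L v (Ψ γ, (1 : (UnitaryGroup.cmDatum L 1 (Matrix.of fun i j : Fin 1 => if i.val + j.val + 1 = 1 then (1 : L) else 0)).Local v)) (η, (1 : (UnitaryGroup.cmDatum L 1 (Matrix.of fun i j : Fin 1 => if i.val + j.val + 1 = 1 then (1 : L) else 0)).Local v)) → ∃ δ ∈ U₀, IsLocalStablyConjH L v (γ, (1 : (UnitaryGroup.cmDatum L 1 (Matrix.of fun i j : Fin 1 => if i.val + j.val + 1 = 1 then (1 : L) else 0)).Local v)) (δ, (1 : (UnitaryGroup.cmDatum L 1 (Matrix.of fun i j : Fin 1 => if i.val + j.val + 1 = 1 then (1 : L) else 0)).Local v)) ∧ Ψ δ = η) ∧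
      (∀ γ ∈ U₀, Ψ γ ∈ U₀) ∧
      (∀ F : (UnitaryGroup.cmDatum L 2 (Matrix.of fun i j : Fin 2 => if i.val + j.val + 1 = 2 then (1 : L) else 0)).Local v × (UnitaryGroup.cmDatum L 1 (Matrix.of fun i j : Fin 1 => if i.val + j.val + 1 = 1 then (1 : L) else 0)).Local v → ℂ, IsLocSmooth F →
        IsLocSmooth ((U₀ ×ˢ (Set.univ : Set ((UnitaryGroup.cmDatum L 1 (Matrix.of fun i j : Fin 1 => if i.val + j.val + 1 = 1 then (1 : L) else 0)).Local v))).indicator (F ∘ fun γ : (UnitaryGroup.cmDatum L 2 (Matrix.of fun i j : Fin 2 => if i.val + j.val + 1 = 2 then (1 : L) else 0)).Local v × (UnitaryGroup.cmDatum L 1 (Matrix.of fun i j : Fin 1 => if i.val + j.val + 1 = 1 then (1 : L) else 0)).Local v => (Ψ γ.1, γ.2)))) ∧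
      1 < ‖q‖ ∧
      (∀ u : ConjClasses ((UnitaryGroup.cmDatum L 2 (Matrix.of fun i j : Fin 2 => if i.val + j.val + 1 = 2 then (1 : L) else 0)).Local v), u ≠ ConjClasses.mk ζ → 1 ≤ a u) ∧
      (∀ lam : (UnitaryGroup.cmDatum L 1 (Matrix.of fun i j : Fin 1 => if i.val + j.val + 1 = 1 then (1 : L) else 0)).Local v, ∃ t : (UnitaryGroup.cmDatum L 2 (Matrix.of fun i j : Fin 2 => if i.val + j.val + 1 = 2 then (1 : L) else 0)).Local v, t ∈ U₀ ∧
        (∀ k : ℕ, IsLocalGRegular L v (Ψ^[k] t, lam)) ∧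
        (∀ k : ℕ, CompactSpace (Subgroup.centralizer ({Ψ^[k] t} : Set ((UnitaryGroup.cmDatum L 2 (Matrix.of fun i j : Fin 2 => if i.val + j.val + 1 = 2 then (1 : L) else 0)).Local v)))) ∧
        (∀ k : ℕ, Irreducible (((Ψ^[k] t).val : GL (Fin 2) (UnitaryGroup.LocalRing L v)).val.charpoly)) ∧
        Tendsto (fun k : ℕ => Ψ^[k] t) atTop (𝓝 ζ)) ∧
      ∀ (S₂ : Finset (ConjClasses ((UnitaryGroup.cmDatum L 2 (Matrix.of fun i j : Fin 2 => if i.val + j.val + 1 = 2 then (1 : L) else 0)).Local v))) (mU₂ : OrbitalMeasureFamily ((UnitaryGroup.cmDatum L 2 (Matrix.of fun i j : Fin 2 => if i.val + j.val + 1 = 2 then (1 : L) else 0)).Local v)),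
        (∀ u ∈ S₂, (((Quotient.out u * ζ⁻¹ : (UnitaryGroup.cmDatum L 2 (Matrix.of fun i j : Fin 2 => if i.val + j.val + 1 = 2 then (1 : L) else 0)).Local v).val : GL (Fin 2) (UnitaryGroup.LocalRing L v)).val - 1) ^ 2 = 0) →
        mU₂.IsAdmissibleOn (fun γ : (UnitaryGroup.cmDatum L 2 (Matrix.of fun i j : Fin 2 => if i.val + j.val + 1 = 2 then (1 : L) else 0)).Local v => ConjClasses.mk γ ∈ S₂) →
        ∀ u ∈ S₂, ∀ G : (UnitaryGroup.cmDatum L 2 (Matrix.of fun i j : Fin 2 => if i.val + j.val + 1 = 2 then (1 : L) else 0)).Local v → ℂ, IsLocSmooth G →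
          classOrbitalIntegral mU₂ (U₀.indicator (G ∘ Ψ)) u = q ^ (a u) * classOrbitalIntegral mU₂ G u) :
    ∀ (L : Type) [Field L] [NumberField L] [IsCMField L] (v : HeightOneSpectrum (𝓞 ↥(maximalRealSubfield L)))
      [MeasurableSpace ((UnitaryGroup.cmDatum L 2 (Matrix.of fun i j : Fin 2 => if i.val + j.val + 1 = 2 then (1 : L) else 0)).Local v × (UnitaryGroup.cmDatum L 1 (Matrix.of fun i j : Fin 1 => if i.val + j.val + 1 = 1 then (1 : L) else 0)).Local v)] [BorelSpace ((UnitaryGroup.cmDatum L 2 (Matrix.of fun i j : Fin 2 => if i.val + j.val + 1 = 2 then (1 : L) else 0)).Local v × (UnitaryGroup.cmDatum L 1 (Matrix.of fun i j : Fin 1 => if i.val + j.val + 1 = 1 then (1 : L) else 0)).Local v)]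
      [∀ a : (UnitaryGroup.cmDatum L 2 (Matrix.of fun i j : Fin 2 => if i.val + j.val + 1 = 2 then (1 : L) else 0)).Local v × (UnitaryGroup.cmDatum L 1 (Matrix.of fun i j : Fin 1 => if i.val + j.val + 1 = 1 then (1 : L) else 0)).Local v,
        MeasurableSpace (((UnitaryGroup.cmDatum L 2 (Matrix.of fun i j : Fin 2 => if i.val + j.val + 1 = 2 then (1 : L) else 0)).Local v × (UnitaryGroup.cmDatum L 1 (Matrix.of fun i j : Fin 1 => if i.val + j.val + 1 = 1 then (1 : L) else 0)).Local v) ⧸ Subgroup.centralizer ({a} : Set ((UnitaryGroup.cmDatum L 2 (Matrix.of fun i j : Fin 2 => if i.val + j.val + 1 = 2 then (1 : L) else 0)).Local v × (UnitaryGroup.cmDatum L 1 (Matrix.of fun i j : Fin 1 => if i.val + j.val + 1 = 1 then (1 : L) else 0)).Local v)))]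
      [∀ a : (UnitaryGroup.cmDatum L 2 (Matrix.of fun i j : Fin 2 => if i.val + j.val + 1 = 2 then (1 : L) else 0)).Local v × (UnitaryGroup.cmDatum L 1 (Matrix.of fun i j : Fin 1 => if i.val + j.val + 1 = 1 then (1 : L) else 0)).Local v,
        BorelSpace (((UnitaryGroup.cmDatum L 2 (Matrix.of fun i j : Fin 2 => if i.val + j.val + 1 = 2 then (1 : L) else 0)).Local v × (UnitaryGroup.cmDatum L 1 (Matrix.of fun i j : Fin 1 => if i.val + j.val + 1 = 1 then (1 : L) else 0)).Local v) ⧸ Subgroup.centralizer ({a} : Set ((UnitaryGroup.cmDatum L 2 (Matrix.of fun i j : Fin 2 => if i.val + j.val + 1 = 2 then (1 : L) else 0)).Local v × (UnitaryGroup.cmDatum L 1 (Matrix.of fun i j : Fin 1 => if i.val + j.val + 1 = 1 then (1 : L) else 0)).Local v)))],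
      Subsingleton (UnitaryGroup.PlacesOver L v) →
    ∀ z : (UnitaryGroup.cmDatum L 2 (Matrix.of fun i j : Fin 2 => if i.val + j.val + 1 = 2 then (1 : L) else 0)).Local v × (UnitaryGroup.cmDatum L 1 (Matrix.of fun i j : Fin 1 => if i.val + j.val + 1 = 1 then (1 : L) else 0)).Local v, z ∈ Subgroup.center ((UnitaryGroup.cmDatum L 2 (Matrix.of fun i j : Fin 2 => if i.val + j.val + 1 = 2 then (1 : L) else 0)).Local v × (UnitaryGroup.cmDatum L 1 (Matrix.of fun i j : Fin 1 => if i.val + j.val + 1 = 1 then (1 : L) else 0)).Local v) →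
    ∃ (Ψ : (UnitaryGroup.cmDatum L 2 (Matrix.of fun i j : Fin 2 => if i.val + j.val + 1 = 2 then (1 : L) else 0)).Local v × (UnitaryGroup.cmDatum L 1 (Matrix.of fun i j : Fin 1 => if i.val + j.val + 1 = 1 then (1 : L) else 0)).Local v → (UnitaryGroup.cmDatum L 2 (Matrix.of fun i j : Fin 2 => if i.val + j.val + 1 = 2 then (1 : L) else 0)).Local v × (UnitaryGroup.cmDatum L 1 (Matrix.of fun i j : Fin 1 => if i.val + j.val + 1 = 1 then (1 : L) else 0)).Local v) (U₀ : Set ((UnitaryGroup.cmDatum L 2 (Matrix.of fun i j : Fin 2 => if i.val + j.val + 1 = 2 then (1 : L) else 0)).Local v × (UnitaryGroup.cmDatum L 1 (Matrix.of fun i j : Fin 1 => if i.val + j.val + 1 = 1 then (1 : L) else 0)).Local v)) (q : ℂ) (a : ConjClasses ((UnitaryGroup.cmDatum L 2 (Matrix.of fun i j : Fin 2 => if i.val + j.val + 1 = 2 then (1 : L) else 0)).Local v × (UnitaryGroup.cmDatum L 1 (Matrix.of fun i j : Fin 1 => if i.val + j.val + 1 = 1 then (1 : L) else 0)).Local v)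 → ℕ) (γs : (UnitaryGroup.cmDatum L 2 (Matrix.of fun i j : Fin 2 => if i.val + j.val + 1 = 2 then (1 : L) else 0)).Local v × (UnitaryGroup.cmDatum L 1 (Matrix.of fun i j : Fin 1 => if i.val + j.val + 1 = 1 then (1 : L) else 0)).Local v),
      U₀ ∈ 𝓝 z ∧
      (∀ γ ∈ U₀, ∀ x : (UnitaryGroup.cmDatum L 2 (Matrix.of fun i j : Fin 2 => if i.val + j.val + 1 = 2 then (1 : L) else 0)).Local v × (UnitaryGroup.cmDatum L 1 (Matrix.of fun i j : Fin 1 => if i.val + j.val + 1 = 1 then (1 : L) else 0)).Local v, x * γ * x⁻¹ ∈ U₀) ∧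
      (∀ γ ∈ U₀, ∀ δ : (UnitaryGroup.cmDatum L 2 (Matrix.of fun i j : Fin 2 => if i.val + j.val + 1 = 2 then (1 : L) else 0)).Local v × (UnitaryGroup.cmDatum L 1 (Matrix.of fun i j : Fin 1 => if i.val + j.val + 1 = 1 then (1 : L) else 0)).Local v, IsLocalStablyConjH L v γ δ → δ ∈ U₀) ∧
      (∀ γ ∈ U₀, ∀ x : (UnitaryGroup.cmDatum L 2 (Matrix.of fun i j : Fin 2 => if i.val + j.val + 1 = 2 then (1 : L) else 0)).Local v × (UnitaryGroup.cmDatum L 1 (Matrix.of fun i j : Fin 1 => if i.val + j.val + 1 = 1 then (1 : L) else 0)).Local v, Ψ (x * γ * x⁻¹) = x * Ψ γ * x⁻¹) ∧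
      (∀ γ ∈ U₀, ∀ y : (UnitaryGroup.cmDatum L 2 (Matrix.of fun i j : Fin 2 => if i.val + j.val + 1 = 2 then (1 : L) else 0)).Local v × (UnitaryGroup.cmDatum L 1 (Matrix.of fun i j : Fin 1 => if i.val + j.val + 1 = 1 then (1 : L) else 0)).Local v, y * γ = γ * y ↔ y * Ψ γ = Ψ γ * y) ∧
      (∀ γ ∈ U₀, ∀ δ ∈ U₀, IsLocalStablyConjH L v γ δ → IsLocalStablyConjH L v (Ψ γ) (Ψ δ)) ∧
      (∀ γ ∈ U₀, ∀ δ ∈ U₀, Ψ γ = Ψ δ → γ = δ) ∧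
      (∀ γ ∈ U₀, ∀ η : (UnitaryGroup.cmDatum L 2 (Matrix.of fun i j : Fin 2 => if i.val + j.val + 1 = 2 then (1 : L) else 0)).Local v × (UnitaryGroup.cmDatum L 1 (Matrix.of fun i j : Fin 1 => if i.val + j.val + 1 = 1 then (1 : L) else 0)).Local v, IsLocalStablyConjH L v (Ψ γ) η → ∃ δ ∈ U₀, IsLocalStablyConjH L v γ δ ∧ Ψ δ = η) ∧
      (∀ γ ∈ U₀, Ψ γ ∈ U₀) ∧
      (∀ F : (UnitaryGroup.cmDatum L 2 (Matrix.of fun i j : Fin 2 => if i.val + j.val + 1 = 2 then (1 : L) else 0)).Local v × (UnitaryGroup.cmDatum L 1 (Matrix.of fun i j : Fin 1 => if i.val + j.val + 1 = 1 then (1 : L) else 0)).Local v → ℂ, IsLocSmooth F → IsLocSmooth (U₀.indicator (F ∘ Ψ))) ∧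
      1 < ‖q‖ ∧
      (∀ u : ConjClasses ((UnitaryGroup.cmDatum L 2 (Matrix.of fun i j : Fin 2 => if i.val + j.val + 1 = 2 then (1 : L) else 0)).Local v × (UnitaryGroup.cmDatum L 1 (Matrix.of fun i j : Fin 1 => if i.val + j.val + 1 = 1 then (1 : L) else 0)).Local v), u ≠ ConjClasses.mk z → 1 ≤ a u) ∧
      (γs ∈ U₀ ∧ (∀ k : ℕ, IsLocalGRegular L v (Ψ^[k] γs) ∧ CompactSpace (Subgroup.centralizer ({Ψ^[k] γs} : Set ((UnitaryGroup.cmDatum L 2 (Matrix.of fun i j : Fin 2 => if i.val + j.val + 1 = 2 then (1 : L) else 0)).Local v × (UnitaryGroup.cmDatum L 1 (Matrix.of fun i j : Fin 1 => if i.val + j.val + 1 = 1 then (1 : L) else 0)).Local v)))) ∧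
        (∀ k : ℕ, ({c : ConjClasses ((UnitaryGroup.cmDatum L 2 (Matrix.of fun i j : Fin 2 => if i.val + j.val + 1 = 2 then (1 : L) else 0)).Local v × (UnitaryGroup.cmDatum L 1 (Matrix.of fun i j : Fin 1 => if i.val + j.val + 1 = 1 then (1 : L) else 0)).Local v) | IsLocalStablyConjH L v (Ψ^[k] γs) (Quotient.out c)} : Set (ConjClasses ((UnitaryGroup.cmDatum L 2 (Matrix.of fun i j : Fin 2 => if i.val + j.val + 1 = 2 then (1 : L) else 0)).Local v × (UnitaryGroup.cmDatum L 1 (Matrix.of fun i j : Fin 1 => if i.val + j.val + 1 = 1 then (1 : L) else 0)).Local v))).ncard = 1) ∧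
        Tendsto (fun k : ℕ => Ψ^[k] γs) atTop (𝓝 z)) ∧
      ∀ (S : Finset (ConjClasses ((UnitaryGroup.cmDatum L 2 (Matrix.of fun i j : Fin 2 => if i.val + j.val + 1 = 2 then (1 : L) else 0)).Local v × (UnitaryGroup.cmDatum L 1 (Matrix.of fun i j : Fin 1 => if i.val + j.val + 1 = 1 then (1 : L) else 0)).Local v))) (mU : OrbitalMeasureFamily ((UnitaryGroup.cmDatum L 2 (Matrix.of fun i j : Fin 2 => if i.val + j.val + 1 = 2 then (1 : L) else 0)).Local v × (UnitaryGroup.cmDatum L 1 (Matrix.of fun i j : Fin 1 => if i.val + j.val + 1 = 1 then (1 : L) else 0)).Local v)),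
        (∀ u ∈ S, ((((Quotient.out u * z⁻¹).1).val : GL (Fin 2) (UnitaryGroup.LocalRing L v)).val - 1) ^ 2 = 0 ∧ (Quotient.out u * z⁻¹).2 = 1) →
        mU.IsAdmissibleOn (fun γ : (UnitaryGroup.cmDatum L 2 (Matrix.of fun i j : Fin 2 => if i.val + j.val + 1 = 2 then (1 : L) else 0)).Local v × (UnitaryGroup.cmDatum L 1 (Matrix.of fun i j : Fin 1 => if i.val + j.val + 1 = 1 then (1 : L) else 0)).Local v => ConjClasses.mk γ ∈ S) →
        ∀ u ∈ S, ∀ F : (UnitaryGroup.cmDatum L 2 (Matrix.of fun i j : Fin 2 => if i.val + j.val + 1 = 2 then (1 : L) else 0)).Local v × (UnitaryGroup.cmDatum L 1 (Matrix.of fun i j : Fin 1 => if i.val + j.val + 1 = 1 then (1 : L) else 0)).Local v → ℂ, IsLocSmooth F →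
          classOrbitalIntegral mU (U₀.indicator (F ∘ Ψ)) u = q ^ (a u) * classOrbitalIntegral mU F u := by
  intro L _ _ _ v _ _ _ _ hns z hz
  classical
  -- Borel σ-algebras on `U₂` and its orbit spaces (the rank-one package is instantiated at them)
  letI : MeasurableSpace ((UnitaryGroup.cmDatum L 2 (Matrix.of fun i j : Fin 2 => if i.val + j.val + 1 = 2 then (1 : L) else 0)).Local v) := borel _
  haveI : BorelSpace ((UnitaryGroup.cmDatum L 2 (Matrix.of fun i j : Fin 2 => if i.val + j.val + 1 = 2 then (1 : L) else 0)).Local v) := ⟨rfl⟩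
  letI : ∀ γ : (UnitaryGroup.cmDatum L 2 (Matrix.of fun i j : Fin 2 => if i.val + j.val + 1 = 2 then (1 : L) else 0)).Local v, MeasurableSpace ((UnitaryGroup.cmDatum L 2 (Matrix.of fun i j : Fin 2 => if i.val + j.val + 1 = 2 then (1 : L) else 0)).Local v ⧸ Subgroup.centralizer ({γ} : Set ((UnitaryGroup.cmDatum L 2 (Matrix.of fun i j : Fin 2 => if i.val + j.val + 1 = 2 then (1 : L) else 0)).Local v))) := fun _ => borel _
  haveI : ∀ γ : (UnitaryGroup.cmDatum L 2 (Matrix.of fun i j : Fin 2 => if i.val + j.val + 1 = 2 then (1 : L) else 0)).Local v, BorelSpace ((UnitaryGroup.cmDatum L 2 (Matrix.of fun i j : Fin 2 => if i.val + j.val + 1 = 2 then (1 : L) else 0)).Local v ⧸ Subgroup.centralizer ({γ} : Set ((UnitaryGroup.cmDatum L 2 (Matrix.of fun i j : Fin 2 => if i.val + j.val + 1 = 2 then (1 : L) else 0)).Local v))) := fun _ => ⟨rfl⟩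
  -- `z.1` is central in `U₂`
  have hζ : z.1 ∈ Subgroup.center ((UnitaryGroup.cmDatum L 2 (Matrix.of fun i j : Fin 2 => if i.val + j.val + 1 = 2 then (1 : L) else 0)).Local v) := Subgroup.mem_center_iff.2 fun k => (fst_comm_of_mem_center hz k).1
  obtain ⟨Ψ, U₀, q, a, hU1, hU2, hU2st, hE, hZ, hEst, hI, hSst, hC, hS, hq, ha, hRAY, hSC⟩ := hpkg L v hns z.1 hζ
  obtain ⟨t, htU, hreg, hcpt, hirr, hlim⟩ := hRAY z.2
  -- non-split bookkeeping
  obtain ⟨w⟩ := UnitaryGroup.PlacesOver.nonempty L v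
  have hns' : ∀ w' : UnitaryGroup.PlacesOver L v, IsCMField.complexConj L • w'.1 = w'.1 :=
    fun w' => smul_placesOver_eq_of_subsingleton L v (IsCMField.complexConj L) hns w'
  obtain ⟨δ, hcδ, hδ⟩ := Literature.NumberTheory.Weil1982.UnitaryFinTopForm.exists_complexConj_eq_neg_ne_zero L
  -- the exponent on `H_v`
  set aH : ConjClasses ((UnitaryGroup.cmDatum L 2 (Matrix.of fun i j : Fin 2 => if i.val + j.val + 1 = 2 then (1 : L) else 0)).Local v × (UnitaryGroup.cmDatum L 1 (Matrix.of fun i j : Fin 1 => if i.val + j.val + 1 = 1 then (1 : L) else 0)).Local v) → ℕ := fun u =>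
    if u = ConjClasses.mk z then a (ConjClasses.mk z.1) else max 1 (a (ConjClasses.mk (Quotient.out u).1)) with haH
  -- on a class over `z`, `aH u = a ⟦(out u).1⟧`
  have haH_over : ∀ u : ConjClasses ((UnitaryGroup.cmDatum L 2 (Matrix.of fun i j : Fin 2 => if i.val + j.val + 1 = 2 then (1 : L) else 0)).Local v × (UnitaryGroup.cmDatum L 1 (Matrix.of fun i j : Fin 1 => if i.val + j.val + 1 = 1 then (1 : L) else 0)).Local v),
      (((((Quotient.out u * z⁻¹).1).val : GL (Fin 2) (UnitaryGroup.LocalRing L v)).val - 1) ^ 2 = 0 ∧ (Quotient.out u * z⁻¹).2 = 1) →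
        aH u = a (ConjClasses.mk (Quotient.out u).1) := by
    intro u hu
    by_cases huz : u = ConjClasses.mk z
    · -- `out ⟦z⟧ = z`
      have hout : Quotient.out u = z :=
        eq_of_isConj_of_mem_center hz (ConjClasses.mk_eq_mk_iff_isConj.1 ((Quotient.out_eq u).trans huz).symm)
      simp only [haH, if_pos huz, hout]
    · simp only [haH, if_neg huz]
      refine max_eq_right (ha _ fun heq => huz ?_)
      -- `⟦(out u).1⟧ = ⟦z.1⟧` forces `(out u).1 = z.1`, and the literal forces `(out u).2 = z.2`
      have h1 : (Quotient.out u).1 = z.1 := eq_of_isConj_of_mem_center hζ (ConjClasses.mk_eq_mk_iff_isConj.1 heq.symm)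
      have h2 : (Quotient.out u).2 = z.2 := by
        have h := hu.2
        change (Quotient.out u).2 * z.2⁻¹ = 1 at h
        rwa [mul_inv_eq_one] at h
      calc u = ConjClasses.mk (Quotient.out u) := (Quotient.out_eq u).symm
        _ = ConjClasses.mk z := by rw [show Quotient.out u = z from Prod.ext h1 h2]
  refine ⟨(fun γ : (UnitaryGroup.cmDatum L 2 (Matrix.of fun i j : Fin 2 => if i.val + j.val + 1 = 2 then (1 : L) else 0)).Local v × (UnitaryGroup.cmDatum L 1 (Matrix.of fun i j : Fin 1 => if i.val + j.val + 1 = 1 then (1 : L) else 0)).Local v => (Ψ γ.1, γ.2)), U₀ ×ˢ (Set.univ : Set ((UnitaryGroup.cmDatum L 1 (Matrix.of fun i j : Fin 1 => if i.val + j.val + 1 = 1 then (1 : L) else 0)).Local v)), q, aH, (t, z.2),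
    ?_, ?_, ?_, ?_, ?_, ?_, ?_, ?_, ?_, hS, hq, ?_, ⟨Set.mk_mem_prod htU (Set.mem_univ _), ?_, ?_, ?_⟩, ?_⟩
  · -- (U1)
    show U₀ ×ˢ (Set.univ : Set ((UnitaryGroup.cmDatum L 1 (Matrix.of fun i j : Fin 1 => if i.val + j.val + 1 = 1 then (1 : L) else 0)).Local v)) ∈ 𝓝 (z.1, z.2)
    exact prod_mem_nhds hU1 Filter.univ_mem
  · -- (U2)
    intro γ hγ x
    exact Set.mk_mem_prod (hU2 _ hγ.1 x.1) (Set.mem_univ _)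
  · -- (U2st)
    intro γ hγ δ' hst
    exact Set.mk_mem_prod (hU2st _ hγ.1 δ'.1 ⟨hst.1, IsStablyConj.refl _⟩) (Set.mem_univ _)
  · -- (E)
    intro γ hγ x
    exact Prod.ext (hE _ hγ.1 x.1) rfl
  · -- (Z)
    intro γ hγ y
    constructor
    · intro h
      have h1 : y.1 * γ.1 = γ.1 * y.1 := congrArg Prod.fst h
      have h2 : y.2 * γ.2 = γ.2 * y.2 := congrArg Prod.snd h
      refine Prod.ext ?_ ?_
      · show y.1 * Ψ γ.1 = Ψ γ.1 * y.1
        exact (hZ _ hγ.1 y.1).1 h1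
      · show y.2 * γ.2 = γ.2 * y.2
        exact h2
    · intro h
      have h1 : y.1 * Ψ γ.1 = Ψ γ.1 * y.1 := congrArg Prod.fst h
      have h2 : y.2 * γ.2 = γ.2 * y.2 := congrArg Prod.snd h
      refine Prod.ext ?_ ?_
      · show y.1 * γ.1 = γ.1 * y.1
        exact (hZ _ hγ.1 y.1).2 h1
      · show y.2 * γ.2 = γ.2 * y.2
        exact h2
  · -- (Est)
    intro γ hγ δ' hδ' hst
    exact ⟨(hEst _ hγ.1 _ hδ'.1 ⟨hst.1, IsStablyConj.refl _⟩).1, hst.2⟩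
  · -- (I)
    intro γ hγ δ' hδ' h
    have h1 : Ψ γ.1 = Ψ δ'.1 := congrArg Prod.fst h
    have h2 : γ.2 = δ'.2 := by
      have h' := congrArg Prod.snd h
      exact h'
    exact Prod.ext (hI _ hγ.1 _ hδ'.1 h1) h2
  · -- (Sst)
    intro γ hγ η hst
    obtain ⟨δ₁, hδ₁U, hst₁, hΨδ₁⟩ := hSst _ hγ.1 η.1 ⟨hst.1, IsStablyConj.refl _⟩
    exact ⟨(δ₁, η.2), Set.mk_mem_prod hδ₁U (Set.mem_univ _), ⟨hst₁.1, hst.2⟩, Prod.ext hΨδ₁ rfl⟩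
  · -- (C)
    intro γ hγ
    exact Set.mk_mem_prod (hC _ hγ.1) (Set.mem_univ _)
  · -- (Q) exponents off `⟦z⟧`
    intro u hne
    simp only [haH, if_neg hne]
    exact le_max_left _ _
  · -- (RAY♮): regularity and compact centralisers along the orbit
    intro k
    rw [iterate_prodMap_fst]
    haveI := hcpt k
    exact ⟨hreg k, compactSpace_centralizerH_of_fst L v hns' (Ψ^[k] t, z.2)⟩
  · -- (RAY♮): ONE class in the stable class (type (2))
    intro k
    rw [iterate_prodMap_fst]
    rw [setOf_st_out_eq_singleton (IsLocalStablyConjH L v) (Ψ^[k] t, z.2) (fun _ h => isStablyConjH_of_isConj h)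
      (fun k' hk' => isConj_of_isStablyConjH_of_irreducible L v (IsCMField.complexConj L) hcδ hδ w (hns' w)
        (adelicForm_antidiagTwo_local_hermitian L v) (isUnit_det_adelicForm_antidiagTwo_local L v) (Ψ^[k] t).2 (hirr k) _ z.2 k' hk')]
    exact Set.ncard_singleton _
  · -- (RAY♮): the orbit tends to `z`
    have h : Tendsto (fun k : ℕ => (Ψ^[k] t, z.2)) atTop (𝓝 (z.1, z.2)) := hlim.prodMk_nhds tendsto_const_nhds
    have hfun : (fun k : ℕ => (fun γ : (UnitaryGroup.cmDatum L 2 (Matrix.of fun i j : Fin 2 => if i.val + j.val + 1 = 2 then (1 : L) else 0)).Local v × (UnitaryGroup.cmDatum L 1 (Matrix.of fun i j : Fin 1 => if i.val + j.val + 1 = 1 then (1 : L) else 0)).Local v => (Ψ γ.1, γ.2))^[k] (t, z.2)) = fun k : ℕ => (Ψ^[k] t, z.2) :=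
      funext fun k => iterate_prodMap_fst L v Ψ t z.2 k
    rw [hfun]
    exact h
  · -- (SC) by FILE 4a
    intro S mU hunip hadm u hu F hF
    rw [haH_over u (hunip u hu)]
    exact classOrbitalIntegral_indicator_comp_prod_eq_mul L v hns hz hSC S mU hunip hadm hu F hF

end Summit.HodgeConjecture.HodgeConjecture.Cruxes.H413.K2E3CentralUnipotentScalingPackageOfRankOne

end
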